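import Summits.CriticalPhenomena.PercolationContinuityZ3.Theorems.Transplant.Slab111VFast
import HarnessLib

/-!
# The routing certificate for `ShapedLinkage 3 (Slab111.hexShadow k)`, I″: a FAST MIRROR of the checker, part B

builds on p205010 (kernel theorem, internal audit signed; external expert review pending) — NOT used in this file.  Lane `prim-bschramm`, seat
`prim-bschramm-p2` (gen 35; class C1b; memo `HOME/bschramm/P2-LATTICES.md` §129); helper file (`--supports stmt-CriticalPhenomena-4575 --as helper`).
Continues «Slab111VFast»: vertex-mask mirrors of self-avoidance (`nodupOKT`) and region avoidance (`regionOKT`) with implication lemmas (the vertex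
id `vidT` is injective on the model window `inRV`), the remaining context mirrors (`termsOKT`, `codeFreeT`, contact checks, `levelsOKT`), the mirrored
checker **`PlanD.checkT`** with **`check_of_checkT`**, and the status side `rideStatusOKT`, `TermD.allowsT`, **`PlanD.allowsT`** with `allowsT_eq`.
-/

namespace Summit.CriticalPhenomena.PercolationContinuityZ3.Theorems.Transplant

namespace Slab111

/-- The context of the fast context. [folklore] -/
@[simp] theorem CtxT.of_C (C : Ctx) : (CtxT.of C).C = C := rfl

/-! ## §3 Self-avoidance and regions by vertex / column masks -/

/-- Vertex in the model window: column in `[−3,3]²`, level in `[−6, 9]`. [folklore] -/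
def inRV (w : MV) : Bool := inR w.1 && decide (-6 ≤ w.2) && decide (w.2 ≤ 9)

/-- Vertex id (as in «Slab111VSearch»): column index `× 16 +` level slot. [folklore] -/
def vidT (w : MV) : ℕ := cidxT w.1 * 16 + (w.2 + 6).toNat

/-- `vidT` is injective on the window. [folklore] -/
theorem vidT_inj {w v : MV} (hw : inRV w = true) (hv : inRV v = true) (h : vidT w = vidT v) : w = v := by
  obtain ⟨⟨a, b⟩, l⟩ := w; obtain ⟨⟨a', b'⟩, l'⟩ := v
  simp only [inRV, inR, Bool.and_eq_true, decide_eq_true_eq] at hw hv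
  simp only [vidT, cidxT] at h
  simp only [Prod.mk.injEq]
  refine ⟨⟨?_, ?_⟩, ?_⟩ <;> omega

/-- Vertex mask of a list. [folklore] -/
def vmask (l : List MV) : ℕ := l.foldl (fun acc w => acc ||| 2 ^ vidT w) 0

/-- A member's bit is set in the vertex mask. [folklore] -/
theorem testBit_vmask {l : List MV} {w : MV} (hw : w ∈ l) : (vmask l).testBit (vidT w) = true := by
  rw [vmask, testBit_foldl_or]
  simp only [Nat.zero_testBit, Bool.false_or, List.any_eq_true, beq_iff_eq]
  exact ⟨w, hw, rfl⟩

/-- A set bit of the vertex mask comes from a member (window vertices). [folklore] -/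
theorem mem_of_testBit_vmask {l : List MV} (hl : ∀ u ∈ l, inRV u = true) {w : MV} (hw : inRV w = true)
    (h : (vmask l).testBit (vidT w) = true) : w ∈ l := by
  rw [vmask, testBit_foldl_or] at h
  simp only [Nat.zero_testBit, Bool.false_or, List.any_eq_true, beq_iff_eq] at h
  obtain ⟨u, hu, he⟩ := h
  rwa [← vidT_inj (hl u hu) hw he]

/-- Disjoint vertex masks: no common member. [folklore] -/
theorem not_mem_of_vmask_and {l₁ l₂ : List MV} (h : (vmask l₁ &&& vmask l₂ == 0) = true) {w : MV} (h₁ : w ∈ l₁) : w ∉ l₂ := by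
  intro h₂
  have := congrArg (fun n => n.testBit (vidT w)) (beq_iff_eq.1 h)
  simp only [Nat.testBit_and, testBit_vmask h₁, testBit_vmask h₂, Bool.and_self, Nat.zero_testBit] at this
  exact Bool.noConfusion this

/-- A vertex whose bit misses the mask is not a member. [folklore] -/
theorem not_mem_of_vmask_bit {l : List MV} {w : MV} (h : (vmask l &&& 2 ^ vidT w == 0) = true) : w ∉ l := by
  intro hw
  have := congrArg (fun n => n.testBit (vidT w)) (beq_iff_eq.1 h)
  simp only [Nat.testBit_and, testBit_vmask hw, Nat.testBit_two_pow_self, Bool.and_self, Nat.zero_testBit] at this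
  exact Bool.noConfusion this

/-- Incremental duplicate test. [folklore] -/
def nodupM : List MV → ℕ → Bool
  | [], _ => true
  | w :: l, m => !(m.testBit (vidT w)) && nodupM l (m ||| 2 ^ vidT w)

/-- `nodupM` proves `Nodup` (window vertices), and no member meets the initial mask. [folklore] -/
theorem nodup_of_nodupM : ∀ (l : List MV) (m : ℕ), (∀ u ∈ l, inRV u = true) → nodupM l m = true →
    l.Nodup ∧ ∀ u ∈ l, m.testBit (vidT u) = false
  | [], _, _, _ => ⟨List.nodup_nil, fun _ h => by simp at h⟩
  | w :: l, m, hl, h => by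
    simp only [nodupM, Bool.and_eq_true, Bool.not_eq_true'] at h
    obtain ⟨hw, hrest⟩ := h
    have hl' : ∀ u ∈ l, inRV u = true := fun u hu => hl u (List.mem_cons_of_mem _ hu)
    obtain ⟨hnd, hbits⟩ := nodup_of_nodupM l _ hl' hrest
    refine ⟨List.nodup_cons.2 ⟨fun hmem => ?_, hnd⟩, fun u hu => ?_⟩
    · have := hbits w hmem
      rw [Nat.testBit_or, Nat.testBit_two_pow_self, Bool.or_true] at this
      exact Bool.noConfusion this
    · rcases List.mem_cons.1 hu with rfl | hu
      · exact hw
      · have := hbits u hu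
        rw [Nat.testBit_or, Bool.or_eq_false_iff] at this
        exact this.1

/-- **Mirror of `PlanD.nodupOK`** by vertex masks. [folklore] -/
def PlanD.nodupOKT (P : PlanD) : Bool :=
  let mA := vmask P.A; let mB := vmask P.B; let m1 := vmask P.T1; let m2 := vmask P.T2
  let ky := 2 ^ vidT P.y; let kb := 2 ^ vidT P.b
  nodupM P.A 0 && nodupM P.B 0 && nodupM P.T1 0 && nodupM P.T2 0 &&
  (mA &&& ky == 0) && (mB &&& ky == 0) && (mA &&& kb == 0) && (mB &&& kb == 0) && !(P.y == P.b) &&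
  (mB &&& mA == 0) && (m1 &&& mA == 0) && (m1 &&& ky == 0) && (m1 &&& mB == 0) &&
  (m2 &&& mA == 0) && (m2 &&& kb == 0) && (m2 &&& mB == 0)

/-- All rigid vertices lie in the window (part of the mirrored validity test). [folklore] -/
def PlanD.inWindow (P : PlanD) : Bool := (P.A ++ P.y :: P.b :: P.B ++ P.T1 ++ P.T2).all inRV

/-- `nodupOKT` with window vertices implies `nodupOK`. [folklore] -/
theorem PlanD.nodupOK_of_nodupOKT (P : PlanD) (hw : P.inWindow = true) (h : P.nodupOKT = true) : P.nodupOK = true := by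
  simp only [PlanD.inWindow, List.all_eq_true, List.mem_append, List.mem_cons] at hw
  have hA : ∀ u ∈ P.A, inRV u = true := fun u hu => hw u (Or.inl (Or.inl (Or.inl hu)))
  have hB : ∀ u ∈ P.B, inRV u = true := fun u hu => hw u (Or.inl (Or.inl (Or.inr (Or.inr (Or.inr hu)))))
  have h1 : ∀ u ∈ P.T1, inRV u = true := fun u hu => hw u (Or.inl (Or.inr hu))
  have h2 : ∀ u ∈ P.T2, inRV u = true := fun u hu => hw u (Or.inr hu)
  simp only [PlanD.nodupOKT, Bool.and_eq_true, Bool.not_eq_true'] at h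
  obtain ⟨⟨⟨⟨⟨⟨⟨⟨⟨⟨⟨⟨⟨⟨⟨nA, nB⟩, n1⟩, n2⟩, ay⟩, by_⟩, ab⟩, bb⟩, yb⟩, ba⟩, a1⟩, y1⟩, b1⟩, a2⟩, b2'⟩, bb2⟩ := h
  simp only [PlanD.nodupOK, Bool.and_eq_true, decide_eq_true_eq, Bool.not_eq_true', List.all_eq_true]
  have nc : ∀ {l : List MV} {w : MV}, w ∉ l → l.contains w = false := fun {l} {w} h => by
    cases hc : l.contains w
    · rfl
    · exact absurd (List.contains_iff_mem.1 hc) h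
  refine ⟨⟨⟨⟨⟨⟨⟨⟨⟨⟨⟨(nodup_of_nodupM _ 0 hA nA).1, (nodup_of_nodupM _ 0 hB nB).1⟩, (nodup_of_nodupM _ 0 h1 n1).1⟩,
    (nodup_of_nodupM _ 0 h2 n2).1⟩, nc (not_mem_of_vmask_bit ay)⟩, nc (not_mem_of_vmask_bit by_)⟩, nc (not_mem_of_vmask_bit ab)⟩,
    nc (not_mem_of_vmask_bit bb)⟩, yb⟩, fun w hwB => nc (not_mem_of_vmask_and ba hwB)⟩, fun w hw1 => ⟨⟨nc (not_mem_of_vmask_and a1 hw1), ?_⟩,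
    nc (not_mem_of_vmask_and b1 hw1)⟩⟩, fun w hw2 => ⟨⟨nc (not_mem_of_vmask_and a2 hw2), ?_⟩, nc (not_mem_of_vmask_and bb2 hw2)⟩⟩
  · have := not_mem_of_vmask_bit (l := P.T1) (w := P.y) y1
    cases e : (w == P.y)
    · rfl
    · exact absurd ((beq_iff_eq.1 e) ▸ hw1) this
  · have := not_mem_of_vmask_bit (l := P.T2) (w := P.b) b2'
    cases e : (w == P.b)
    · rfl
    · exact absurd ((beq_iff_eq.1 e) ▸ hw2) this

/-- Column mask of a footprint. [folklore] -/
def footMask (a : AttD) : ℕ := a.foot.foldl (fun acc q => acc ||| 2 ^ cidxT q) 0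

/-- A footprint column's bit is set. [folklore] -/
theorem testBit_footMask {a : AttD} {q : Col} (hq : q ∈ a.foot) : (footMask a).testBit (cidxT q) = true := by
  rw [footMask, testBit_foldl_or]
  simp only [Nat.zero_testBit, Bool.false_or, List.any_eq_true, beq_iff_eq]
  exact ⟨q, hq, rfl⟩

/-- Region avoidance of a list: by disjoint column masks, else vertex by vertex. [folklore] -/
def regionFree (t : TermD) (l : List MV) : Bool :=
  match t with
  | TermD.exact _ => true
  | TermD.ride a _ => (colMask l &&& footMask a == 0) || l.all (fun w => !t.blocks w)

/-- `regionFree` implies vertex-wise avoidance. [folklore] -/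
theorem all_not_blocks_of_regionFree {t : TermD} {l : List MV} (h : regionFree t l = true) : l.all (fun w => !t.blocks w) = true := by
  cases t with
  | exact v => simp [TermD.blocks]
  | ride a e =>
    simp only [regionFree, Bool.or_eq_true] at h
    rcases h with h | h
    · simp only [List.all_eq_true, Bool.not_eq_true', TermD.blocks, Bool.and_eq_false_iff]
      intro w hw
      left
      cases hc : a.foot.contains w.1
      · rfl
      · have hq := testBit_footMask (List.contains_iff_mem.1 hc)
        have := congrArg (fun n => n.testBit (cidxT w.1)) (beq_iff_eq.1 h)
        simp only [Nat.testBit_and, testBit_colMask hw, hq, Bool.and_self, Nat.zero_testBit] at this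
        exact Bool.noConfusion this
    · exact h

/-- **Mirror of `PlanD.regionOK`.** [folklore] -/
def PlanD.regionOKT (P : PlanD) : Bool :=
  regionFree P.t1 (P.A.tail ++ P.y :: P.b :: P.B ++ P.T1 ++ P.T2) &&
  regionFree P.t2 (P.A ++ P.y :: P.b :: P.B.dropLast ++ P.T1 ++ P.T2) &&
  regionFree P.t3a (P.A ++ P.y :: P.B ++ P.T1.dropLast) &&
  regionFree P.t3b (P.A ++ P.b :: P.B ++ P.T2.dropLast) &&
  !P.t1.clash P.t2 && !P.t1.clash P.t3a && !P.t2.clash P.t3a && !P.t1.clash P.t3b && !P.t2.clash P.t3b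

/-- `regionOKT` implies `regionOK`. [folklore] -/
theorem PlanD.regionOK_of_regionOKT (P : PlanD) (h : P.regionOKT = true) : P.regionOK = true := by
  simp only [PlanD.regionOKT, Bool.and_eq_true] at h
  obtain ⟨⟨⟨⟨⟨⟨⟨⟨r1, r2⟩, r3⟩, r4⟩, c1⟩, c2⟩, c3⟩, c4⟩, c5⟩ := h
  simp only [PlanD.regionOK, Bool.and_eq_true]
  exact ⟨⟨⟨⟨⟨⟨⟨⟨all_not_blocks_of_regionFree r1, all_not_blocks_of_regionFree r2⟩, all_not_blocks_of_regionFree r3⟩,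
    all_not_blocks_of_regionFree r4⟩, c1⟩, c2⟩, c3⟩, c4⟩, c5⟩

/-- Mirror of `PlanD.termsOK`. [folklore] -/
def PlanD.termsOKT (T : CtxT) (P : PlanD) : Bool :=
  P.t1.okT T true && P.t2.okT T true && P.t3a.okT T false && P.t3b.okT T false

/-- `termsOKT` equals `termsOK`. [folklore] -/
theorem PlanD.termsOKT_eq (C : Ctx) (P : PlanD) : P.termsOKT (CtxT.of C) = P.termsOK C := by
  simp only [PlanD.termsOKT, PlanD.termsOK, TermD.okT_eq]

/-- Mirror of `codeFree`. [folklore] -/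
def codeFreeT (T : CtxT) (code : ℕ) (q : Col) : Bool := !T.hasCodeT q code

/-- `codeFreeT` equals `codeFree`. [folklore] -/
theorem codeFreeT_eq (C : Ctx) (code : ℕ) (q : Col) : codeFreeT (CtxT.of C) code q = codeFree C code q := by
  simp only [codeFreeT, codeFree, hasCodeT_eq]

/-- Mirror of `portBotOK`. [folklore] -/
def portBotOKT (T : CtxT) (ell : ℤ) : TermD × MV → Bool
  | (TermD.ride a _, p) => bimp (ell + p.2 == 0) (codeFreeT T 1 (a.colBot T.C.c0 1))
  | _ => true

/-- `portBotOKT` equals `portBotOK`. [folklore] -/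
theorem portBotOKT_eq (C : Ctx) (ell : ℤ) : portBotOKT (CtxT.of C) ell = portBotOK C ell := by
  funext tp
  obtain ⟨t, p⟩ := tp
  cases t with
  | exact v => rfl
  | ride a e => simp only [portBotOKT, portBotOK, codeFreeT_eq]; rfl

/-- Mirror of `portTopOK`. [folklore] -/
def portTopOKT (T : CtxT) (j0 : ℤ) : TermD × MV → Bool
  | (TermD.ride a _, p) => bimp (j0 - p.2 == 0) (codeFreeT T 2 (a.colTop T.C.c0 T.C.kr 1))
  | _ => true

/-- `portTopOKT` equals `portTopOK`. [folklore] -/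
theorem portTopOKT_eq (C : Ctx) (j0 : ℤ) : portTopOKT (CtxT.of C) j0 = portTopOK C j0 := by
  funext tp
  obtain ⟨t, p⟩ := tp
  cases t with
  | exact v => rfl
  | ride a e => simp only [portTopOKT, portTopOK, codeFreeT_eq]; rfl

/-- Mirror of `PlanD.contactBotOK`. [folklore] -/
def PlanD.contactBotOKT (T : CtxT) (P : PlanD) (d : ℤ) : Bool :=
  let ell := d - P.lamMin
  P.rigid.all (fun w => bimp (ell + w.2 == 0) (codeFreeT T 0 w.1) && bimp (ell + w.2 == 1) (codeFreeT T 1 w.1)) && P.ridePorts.all (portBotOKT T ell)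

/-- `contactBotOKT` equals `contactBotOK`. [folklore] -/
theorem PlanD.contactBotOKT_eq (C : Ctx) (P : PlanD) (d : ℤ) : P.contactBotOKT (CtxT.of C) d = P.contactBotOK C d := by
  simp only [PlanD.contactBotOKT, PlanD.contactBotOK, codeFreeT_eq, portBotOKT_eq]

/-- Mirror of `PlanD.contactTopOK`. [folklore] -/
def PlanD.contactTopOKT (T : CtxT) (P : PlanD) (d : ℤ) : Bool :=
  let j0 := d + P.lamMax
  P.rigid.all (fun w => bimp (j0 - w.2 == 0) (codeFreeT T 3 w.1) && bimp (j0 - w.2 == 1) (codeFreeT T 2 w.1)) && P.ridePorts.all (portTopOKT T j0)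

/-- `contactTopOKT` equals `contactTopOK`. [folklore] -/
theorem PlanD.contactTopOKT_eq (C : Ctx) (P : PlanD) (d : ℤ) : P.contactTopOKT (CtxT.of C) d = P.contactTopOK C d := by
  simp only [PlanD.contactTopOKT, PlanD.contactTopOK, codeFreeT_eq, portTopOKT_eq]

/-- Mirror of `PlanD.levelsOK`. [folklore] -/
def PlanD.levelsOKT (T : CtxT) (P : PlanD) : Bool :=
  match P.kind with
  | Kind.free =>
      bimp ((0 - P.lamMin) % 3 == (T.C.c0 : ℤ) % 3) (P.contactBotOKT T 0) && bimp ((1 - P.lamMin) % 3 == (T.C.c0 : ℤ) % 3) (P.contactBotOKT T 1) &&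
      bimp (((T.C.kr : ℤ) - 0 - P.lamMax) % 3 == (T.C.c0 : ℤ) % 3) (P.contactTopOKT T 0) &&
      bimp (((T.C.kr : ℤ) - 1 - P.lamMax) % 3 == (T.C.c0 : ℤ) % 3) (P.contactTopOKT T 1)
  | Kind.bot ell => (ell % 3 == (T.C.c0 : ℤ) % 3) && decide (0 ≤ ell + P.lamMin) &&
      bimp (ell + P.lamMin == 0) (P.contactBotOKT T 0) && bimp (ell + P.lamMin == 1) (P.contactBotOKT T 1)
  | Kind.top m => (((T.C.kr : ℤ) - m) % 3 == (T.C.c0 : ℤ) % 3) && decide (P.lamMax ≤ m) &&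
      bimp (P.lamMax == m) (P.contactTopOKT T 0) && bimp (P.lamMax == m - 1) (P.contactTopOKT T 1)
  | Kind.stk lam0 _ => decide (lam0 - 1 ≤ P.lamMin) && decide (P.lamMax ≤ lam0 + 4)

/-- `levelsOKT` equals `levelsOK`. [folklore] -/
theorem PlanD.levelsOKT_eq (C : Ctx) (P : PlanD) : P.levelsOKT (CtxT.of C) = P.levelsOK C := by
  unfold PlanD.levelsOKT PlanD.levelsOK
  cases P.kind <;> simp only [PlanD.contactBotOKT_eq, PlanD.contactTopOKT_eq] <;> rfl

/-- **Mirror of `PlanD.check`** (residue-independent part first, so that the kernel shares it between the residues). [folklore] -/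
def PlanD.checkT (T : CtxT) (P : PlanD) : Bool :=
  (P.structOK && P.inWindow && P.nodupOKT && P.portOK && P.regionOKT) && (P.validOKT T && P.termsOKT T && P.envOK T.C && P.levelsOKT T)

/-- **`checkT` implies `check`.** [folklore] -/
theorem PlanD.check_of_checkT (C : Ctx) (P : PlanD) (h : P.checkT (CtxT.of C) = true) : P.check C = true := by
  simp only [PlanD.checkT, Bool.and_eq_true, PlanD.termsOKT_eq, PlanD.levelsOKT_eq] at h
  obtain ⟨⟨⟨⟨⟨h1, hw⟩, h3⟩, h4⟩, h5⟩, ⟨⟨h2, h6⟩, h7⟩, h8⟩ := h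
  simp only [PlanD.check, Bool.and_eq_true]
  exact ⟨⟨⟨⟨⟨⟨⟨h1, PlanD.validOK_of_validOKT C P h2⟩, PlanD.nodupOK_of_nodupOKT P hw h3⟩, h4⟩, PlanD.regionOK_of_regionOKT P h5⟩, h6⟩, h7⟩, h8⟩

/-- Mirror of `rideStatusOK`. [folklore] -/
def rideStatusOKT (T : CtxT) (a : AttD) (s : ℕ) : Bool :=
  if s ≤ 2 then
    let t : ℤ := s + a.ext
    !(a.ext == -1 && s == 0) &&
      (if t ≤ 0 then codeFreeT T 0 (a.colBot T.C.c0 0) else true) && (if t ≤ 1 then codeFreeT T 1 (a.colBot T.C.c0 1) else true)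
  else if 10 ≤ s then
    let j : ℤ := 12 - s - a.ext
    !(a.ext == 1 && s == 12) &&
      (if j ≤ 0 then codeFreeT T 3 (a.colTop T.C.c0 T.C.kr 0) else true) && (if j ≤ 1 then codeFreeT T 2 (a.colTop T.C.c0 T.C.kr 1) else true)
  else true

/-- `rideStatusOKT` equals `rideStatusOK`. [folklore] -/
theorem rideStatusOKT_eq (C : Ctx) (a : AttD) (s : ℕ) : rideStatusOKT (CtxT.of C) a s = rideStatusOK C a s := by
  simp only [rideStatusOKT, rideStatusOK, codeFreeT_eq]; rfl

/-- Mirror of `TermD.allows`. [folklore] -/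
def TermD.allowsT (T : CtxT) (kind : Kind) : TermD → ℕ → Bool
  | TermD.exact v, s => match kind with
      | Kind.bot ell => decide (s ≤ 2) && (ell + v.2 == s)
      | Kind.top m => decide (10 ≤ s) && decide (s ≤ 12) && (m - v.2 == 12 - s)
      | Kind.stk _ _ => s == 9
      | Kind.free => false
  | TermD.ride a e, s => rideStatusOKT T a s && (match e with
      | Env.any => true
      | Env.ge _ => decide (9 ≤ s) && decide (s ≤ 12)
      | Env.le _ => decide (s ≤ 9)) &&
      (match kind with | Kind.stk _ _ => (match e with | Env.ge _ => s == 9 | _ => true) | _ => true)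

/-- `TermD.allowsT` equals `TermD.allows`. [folklore] -/
theorem TermD.allowsT_eq (C : Ctx) (kind : Kind) (t : TermD) (s : ℕ) : t.allowsT (CtxT.of C) kind s = t.allows C kind s := by
  cases t with
  | exact v => rfl
  | ride a e => simp only [TermD.allowsT, TermD.allows, rideStatusOKT_eq]; rfl

/-- **Mirror of `PlanD.allows`.** [folklore] -/
def PlanD.allowsT (T : CtxT) (P : PlanD) (s1 s2 s3 : ℕ) : Bool :=
  P.t1.allowsT T P.kind s1 && P.t2.allowsT T P.kind s2 && P.t3a.allowsT T P.kind s3 && P.t3b.allowsT T P.kind s3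

/-- **`allowsT` equals `allows`.** [folklore] -/
theorem PlanD.allowsT_eq (C : Ctx) (P : PlanD) (s1 s2 s3 : ℕ) : P.allowsT (CtxT.of C) s1 s2 s3 = P.allows C s1 s2 s3 := by
  simp only [PlanD.allowsT, PlanD.allows, TermD.allowsT_eq]

end Slab111

end Summit.CriticalPhenomena.PercolationContinuityZ3.Theorems.Transplant
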